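import Literature.Probability.Percolation.SlabRSWGluingLobe
import Literature.Probability.Percolation.SlabRSWGluingLinearOfLocated
import HarnessLib

/-!
# Newman–Tassion–Wu 2017, §3.2 / §3.4 — GL in an L-shaped domain: the `B`-near surgery from PORT
# DATA (ports over the trunk box, on the column of `B`, or in the lobe), direct gluing near `A`, the
# located-gadget supply, and Theorem 3.7 in both regimes

Topic: `Literature/Probability/Percolation`. Continuation of `SlabRSWGluingLobe.lean` (`LobeSetup`:
`S = [a,b]×[c,d]`, lobe `V = [a,a']×[c',c-1]`, `R = S ∪ V`, `B` = left side of `S`, `A ⊆ S` off the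
column `a`, `C ⊆ R`). When the cleared box meets the column `x = a` of `B` it lies over the lobe's
columns (lobe at least `2ρ + 7` wide), so `(z + B_r) ∩ R` is a rectangle reaching down into the lobe:
the trunk runs in `(z + B_r) ∩ S` minus the column `a` to a vertex `β ∈ B̄`; the branch reaches the port
directly, or through an exterior path along the column `a`, or through an exterior L-path in the lobe.

* `exists_surgeryB_lobe_at`, `exists_directGlue_A_lobe_at`, `exists_gadgetAt_lobe`,
  **`glue_highProb_lobe`** (high-probability regime, unconditional), **`glue_linear_lobe`** (linear regime).

## Sources

* C. M. Newman, V. Tassion, W. Wu, *Critical percolation and the minimal spanning tree in slabs*,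
  Comm. Pure Appl. Math. 70 (2017), arXiv:1512.09107: §3.2 (Theorem 3.7, proof, steps (1)–(3), Facts
  1–2; Remarks 2–3), §3.4 (proof of Theorem 3.10, (3.65)–(3.70)) [NewmanTassionWu2017].
-/

noncomputable section

namespace Literature.Probability.Percolation

open MeasureTheory LatticeModels SimpleGraph

namespace NTW17

variable {k : ℕ}

/-! ## The `B`-near surgery from port data -/

section AtB

variable {G : LobeSetup} {ω : BondConfig (slab 3 k)} {ρ : ℕ}

/-- **The `B`-near surgery at a prescribed entry cell, from port data** (L-shaped domain; the cleared
box meets the column `x = a` of `B` and therefore lies over the lobe's columns): a surgery ending in `B̄`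
whose cleared set is inside `z + B_{ρ+3}`; the branch to the port is direct, or continues along the
column `a`, or by an exterior L-path through the lobe.
[cite: NewmanTassionWu2017, §3.2 (proof of Theorem 3.7, steps (1)–(3); Fact 2, ω^{(z)}), Remark 2] -/
theorem exists_surgeryB_lobe_at (hk : 1 ≤ k) (hρ : 2 ≤ ρ) (hω : ω ⊆ (slabGraph 3 k).edgeSet)
    (hX : ω ∈ G.Q.evX k) (hwide : G.a + 2 * ρ + 6 ≤ G.a')
    {c₀ wfar vnear : slab 3 k} {Lfar : List (slab 3 k)} (hc₀ : c₀ ∈ slabLift k G.C)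
    (hLfar : IsOSAP k ω (slabLift k G.R ∩ {x | ¬Near k (G.Q.γ k ω) ρ (planar k x)}) {c₀} {wfar} Lfar)
    (hwv : (slabGraph 3 k).Adj wfar vnear) (hvR : vnear ∈ slabLift k G.R)
    (hnear : Near k (G.Q.γ k ω) ρ (planar k vnear))
    (hnA : ∀ a' ∈ G.A, a' ∉ sqBox (planar k vnear) (ρ + 3))
    (hnC : ∀ c' ∈ G.C, c' ∉ sqBox (planar k vnear) (ρ + 3))
    (hcol : (planar k vnear).1 - (ρ + 3) ≤ G.a) :
    ∃ sb : G.Q.SurgeryB k ω, sb.D ⊆ sqBox (planar k vnear) (ρ + 3) := by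
  have hA : ω ∈ G.Q.evAB k := hX.1
  obtain ⟨hγO, -⟩ := G.Q.γ_spec hA
  set z := planar k vnear with hzdef
  set r : ℕ := ρ + 3 with hrdef
  set D := G.DR z r with hDdef
  set K : Set (ℤ × ℤ) := boxR (G.a + 1) (z.1 + r) (max G.c (z.2 - r)) (min G.d (z.2 + r)) with hKdef
  have hzR : z ∈ G.R := hvR
  obtain ⟨hz1, hz2, hz3, hz4⟩ := LobeSetup.contact_bounds hA hzR hnear
  have hab := G.hab; have hcd := G.hcd; have haa' := G.haa'; have ha'b := G.ha'b
  have hDz : D ⊆ sqBox z (ρ + 3) := LobeSetup.DR_subset_sqBox _ _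
  have hc₀D : planar k c₀ ∉ D := fun h => hnC _ hc₀ (hDz h)
  have hDA : ∀ w ∈ D, w ∉ G.Q.A := fun w hw hwA => hnA w hwA (hDz hw)
  -- membership criteria
  have memK : ∀ w : ℤ × ℤ, G.a + 1 ≤ w.1 → w.1 ≤ z.1 + r → G.c ≤ w.2 → w.2 ≤ G.d → z.2 - r ≤ w.2 →
      w.2 ≤ z.2 + r → w ∈ K := by
    intro w h1 h2 h3 h4 h5 h6
    rw [hKdef, mem_boxR_iff]
    simp only [max_le_iff, le_min_iff]
    exact ⟨h1, h2, ⟨h3, h5⟩, h4, h6⟩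
  have Kmem : ∀ w : ℤ × ℤ, w ∈ K → G.a + 1 ≤ w.1 ∧ w.1 ≤ z.1 + r ∧ G.c ≤ w.2 ∧ w.2 ≤ G.d ∧
      z.2 - r ≤ w.2 ∧ w.2 ≤ z.2 + r := by
    intro w hw
    rw [hKdef, mem_boxR_iff] at hw
    simp only [max_le_iff, le_min_iff] at hw
    omega
  have memDS : ∀ w : ℤ × ℤ, G.a ≤ w.1 → w.1 ≤ z.1 + r → G.c ≤ w.2 → w.2 ≤ G.d → z.2 - r ≤ w.2 →
      w.2 ≤ z.2 + r → w ∈ D := by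
    intro w h1 h2 h3 h4 h5 h6
    refine LobeSetup.DS_subset_DR _ _ (LobeSetup.mem_DS_iff.2 ⟨?_, ?_⟩)
    · rw [LobeSetup.mem_S_iff]; omega
    · rw [mem_sqBox_iff']; omega
  have memDV : ∀ w : ℤ × ℤ, G.a ≤ w.1 → w.1 ≤ z.1 + r → G.c' ≤ w.2 → w.2 ≤ G.c - 1 → z.2 - r ≤ w.2 →
      w.2 ≤ z.2 + r → w ∈ D := by
    intro w h1 h2 h3 h4 h5 h6
    refine LobeSetup.DV_subset_DR _ _ (LobeSetup.mem_DV_iff.2 ⟨?_, ?_⟩)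
    · rw [LobeSetup.mem_V_iff]; omega
    · rw [mem_sqBox_iff']; omega
  have Dmem : ∀ w : ℤ × ℤ, w ∈ D → G.a ≤ w.1 ∧ w.1 ≤ z.1 + r ∧ z.2 - r ≤ w.2 ∧ w.2 ≤ z.2 + r ∧
      w.2 ≤ G.d ∧ (G.c ≤ w.2 ∨ (G.c' ≤ w.2 ∧ w.2 ≤ G.c - 1)) := by
    intro w hw
    rcases LobeSetup.mem_DR_iff.1 hw with ⟨hwR, hwb⟩
    rw [mem_sqBox_iff'] at hwb
    rw [LobeSetup.mem_R_iff, LobeSetup.mem_S_iff, LobeSetup.mem_V_iff] at hwR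
    omega
  have hKD : K ⊆ D := fun w hw => by
    obtain ⟨h1, h2, h3, h4, h5, h6⟩ := Kmem w hw; exact memDS w (by omega) h2 h3 h4 h5 h6
  have hKS : K ⊆ G.S := fun w hw => by
    obtain ⟨h1, h2, h3, h4, h5, h6⟩ := Kmem w hw
    rw [LobeSetup.mem_S_iff]; omega
  have notK_a : ∀ w : ℤ × ℤ, w.1 = G.a → w ∉ K := fun w hw h => by have := (Kmem w h).1; omega
  have notK_low : ∀ w : ℤ × ℤ, w.2 ≤ G.c - 1 → w ∉ K := fun w hw h => by have := (Kmem w h).2.2.1; omega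
  have hrows : max G.c (z.2 - (r : ℕ)) + 3 ≤ min G.d (z.2 + (r : ℕ)) := by
    simp only [max_add, le_min_iff, max_le_iff]; omega
  -- the port: the first entry of the far path into `D̄`
  have hwL : wfar ∈ Lfar := by
    have := hLfar.last_mem hLfar.ne_nil
    rw [Set.mem_singleton_iff] at this
    rw [← this]; exact List.getLast_mem _
  have hwfarD : planar k wfar ∈ D := by
    refine LobeSetup.mem_DR_iff.2 ⟨(hLfar.subset wfar hwL).1, sqBox_mono _ (by omega : 1 ≤ r) ?_⟩
    exact planar_mem_sqBox_one_of_adj hwv.symm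
  have hheadL : Lfar.head hLfar.ne_nil = c₀ := by
    have := hLfar.head_mem hLfar.ne_nil
    rwa [Set.mem_singleton_iff] at this
  have hheadD : planar k (Lfar.head hLfar.ne_nil) ∉ D := by rw [hheadL]; exact hc₀D
  obtain ⟨mfar, w', restfar, hmfar, hLeqfar, hmfarD, hw'D, hedgefar, -, -, hconnfar, -⟩ :=
    exists_entry (R := G.R) hLfar.chain hLfar.nodup (fun x hx => (hLfar.subset x hx).1) hLfar.ne_nil
      hheadD ⟨wfar, hwL, hwfarD⟩
  rw [hheadL] at hconnfar
  set q₁ := mfar.getLast hmfar with hq₁def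
  have hadj : (slabGraph 3 k).Adj w' q₁ := ((SimpleGraph.mem_edgeSet _).1 (hω hedgefar)).symm
  have hq₁D : planar k q₁ ∉ D := hmfarD _ (List.getLast_mem hmfar)
  have hσ : ω ∈ openConnIn (slabLift k (G.Q.R \ D)) q₁ c₀ := openConnIn_reverse hconnfar
  have hw'far : ¬Near k (G.Q.γ k ω) ρ (planar k w') := (hLfar.subset w' (by rw [hLeqfar]; simp)).2
  -- a vertex of `γ` over `D` other than the last
  obtain ⟨g₀, hg₀, hz⟩ := hnear
  have hg₀z : planar k g₀ ∈ sqBox z ρ := GlueGeom.mem_sqBox_comm hz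
  have hg₀h := ne_head_of_far_A (Q := G.Q) hA hz (by omega : ρ ≤ ρ + 3) hnA
  have γD : ∀ x ∈ G.Q.γ k ω, planar k x ∈ sqBox z r → planar k x ∈ D := by
    intro x hx hxb
    have hxS := LobeSetup.mem_S_iff.1 (hγO.subset x hx)
    rw [mem_sqBox_iff'] at hxb
    exact memDS _ hxS.1 hxb.2.1 hxS.2.2.1 hxS.2.2.2 hxb.2.2.1 hxb.2.2.2
  have hin : ∃ x ∈ G.Q.γ k ω, planar k x ∈ D ∧ x ≠ (G.Q.γ k ω).getLast hγO.ne_nil := by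
    by_cases hlast : g₀ = (G.Q.γ k ω).getLast hγO.ne_nil
    · obtain ⟨u, huγ, hadj₀, -, hul⟩ := exists_pred hω hA hg₀ hg₀h
      refine ⟨u, huγ, γD u huγ (sqBox_mono _ (by omega : ρ + 1 ≤ r) ?_), hul⟩
      exact mem_sqBox_add hg₀z (planar_mem_sqBox_one_of_adj hadj₀.symm)
    · exact ⟨g₀, hg₀, γD g₀ hg₀ (sqBox_mono _ (by omega) hg₀z), hlast⟩
  -- the decomposition at the first vertex over `D`
  obtain ⟨p₀, E₁, rest, hγeq, hp₀, hrest, hp₀D, hE₁D⟩ := exists_decompB (Q := G.Q) hA hDA hin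
  have hE₁γ : E₁ ∈ G.Q.γ k ω := by rw [hγeq]; simp
  have hE₁B : planar k E₁ ∉ G.B := by
    intro hB'
    have hex : ∃ l, IsOSAP k ω (slabLift k G.Q.S) (slabLift k G.Q.A) (slabLift k G.Q.B) l :=
      (mem_slabConn_iff_exists_isOSAP ω _ _ _).1 hA
    have h := minPath_prefix_getLast_not_mem G.Q.S_finite hex (p := p₀ ++ [E₁]) (s := rest)
      (by rw [show minPath k ω _ _ _ = G.Q.γ k ω from rfl, hγeq]; simp) hrest (by simp)
    simp at h
    exact h hB'
  have hE₁S : planar k E₁ ∈ G.S := hγO.subset E₁ hE₁γ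
  set e₁ := planar k E₁ with he₁def
  have he₁S := LobeSetup.mem_S_iff.1 hE₁S
  have he₁a : e₁.1 ≠ G.a := fun h => hE₁B ⟨hE₁S, h⟩
  obtain ⟨-, he₁2, he₁3, he₁4, he₁5, -⟩ := Dmem _ hE₁D
  have hE₁K : e₁ ∈ K := memK _ (by omega) he₁2 he₁S.2.2.1 he₁S.2.2.2 he₁3 he₁4
  set ew := planar k w' with hewdef
  set h : ℕ := ht w' with hhdef
  have hhk : h ≤ k := ht_le w'
  obtain ⟨hw1, hw2, hw3, hw4, hw5, hw6⟩ := Dmem _ hw'D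
  have hw'E₁ : planar k E₁ ≠ planar k w' :=
    (ne_planar_of_not_near (fun hn => hw'far (hn.mono (by omega))) hE₁γ).symm
  -- the row of `β`: avoid the row of `E₁`, the row of the port, and the bottom row `c`
  obtain ⟨yβ, hyβ1, hyβ2, hyβe, hyβw, hyβc⟩ := exists_row_avoid hrows e₁.2 ew.2 G.c
  have hyβ : G.c ≤ yβ ∧ yβ ≤ G.d ∧ z.2 - r ≤ yβ ∧ yβ ≤ z.2 + r := by
    simp only [max_le_iff, le_min_iff] at hyβ1 hyβ2; omega
  set hβ : ℕ := if h = 0 then 1 else 0 with hhβdef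
  have hhβk : hβ ≤ k := by rw [hhβdef]; split_ifs <;> omega
  have hhβne : hβ ≠ h := by rw [hhβdef]; split_ifs with h' <;> omega
  set β : slab 3 k := vtx k (G.a, yβ) hβ with hβdef
  set β' : slab 3 k := vtx k (G.a + 1, yβ) hβ with hβ'def
  have hβp : planar k β = (G.a, yβ) := planar_vtx _ _
  have hβ'p : planar k β' = (G.a + 1, yβ) := planar_vtx _ _
  have hβht : ht β = hβ := ht_vtx hhβk _
  have hβS : planar k β ∈ G.S := by rw [hβp, LobeSetup.mem_S_iff]; dsimp only; omega
  have hβB : planar k β ∈ G.B := ⟨hβS, by rw [hβp]⟩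
  have hβD : planar k β ∈ D := by
    rw [hβp]; refine memDS _ ?_ ?_ ?_ ?_ ?_ ?_ <;> dsimp only <;> omega
  have hβ'K : planar k β' ∈ K := by
    rw [hβ'p]; refine memK _ ?_ ?_ ?_ ?_ ?_ ?_ <;> dsimp only <;> omega
  have hadjβ : (slabGraph 3 k).Adj β' β := by
    refine adj_of_planarAdj (by rw [hβdef, hβ'def, ht_vtx hhβk, ht_vtx hhβk]) ?_
    rw [hβp, hβ'p]
    exact planarAdj_symm (planarAdj_left (by simp) (by simp))
  have hE₁β' : E₁ ≠ β' := by
    intro hE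
    have := congrArg (fun v => (planar k v).2) hE
    simp only [hβ'p] at this
    exact hyβe (by rw [he₁def, this])
  have hβ'w' : planar k β' ≠ ew := by
    intro hE
    have := congrArg Prod.snd hE
    rw [hβ'p] at this
    exact hyβw this
  have notK_L : ∀ {L : List (slab 3 k)}, (∀ v ∈ L, planar k v ∈ K) → β ∉ L := fun hL hm =>
    notK_a _ (by rw [hβp]) (hL β hm)
  -- the route: trunk `E₁ → β'` in `K`, branch to `w'` inside `D`
  obtain ⟨L, Br₁, c, spec₁, hLK, hβBr₁⟩ : ∃ L Br₁ c, RouteSpec k K D E₁ β' w' L Br₁ c ∧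
      (∀ v ∈ L, planar k v ∈ K) ∧ β ∉ Br₁ := by
    by_cases hcase : planar k w' ∈ K
    · -- the port lies over the trunk box: route to it directly
      obtain ⟨L, Br, c, spec⟩ := exists_route (xL := G.a + 1) (xR' := z.1 + (r : ℕ)) (xR := z.1 + (r : ℕ))
        (rB := max G.c (z.2 - (r : ℕ))) (rP := min G.d (z.2 + (r : ℕ))) (rT := min G.d (z.2 + (r : ℕ)))
        hk (by omega) le_rfl hrows le_rfl hE₁K hβ'K hcase hE₁β' hw'E₁ hβ'w'
      refine ⟨L, Br, c, RouteSpec.mono spec subset_rfl hKD, spec.hL_sub, fun hm => ?_⟩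
      exact notK_a _ (by rw [hβp]) (spec.hBr_sub β hm)
    · -- the port lies on the column `a` or in the lobe: anchor `w''` in `K`, exterior path `X` to `w'`
      -- the anchor: on the column `a + 1` in a free row (port on the column `a`), or on the row `c`
      -- in a free column (port in the lobe)
      obtain ⟨ya, hya1, hya2, hyae, hyaβ, -⟩ := exists_row_avoid hrows e₁.2 yβ yβ
      obtain ⟨xa, hxa1, hxa2, hxae, -, -⟩ :=
        exists_row_avoid (rB := G.a + 1) (rP := G.a + 1 + 3) (by omega) e₁.1 e₁.1 e₁.1
      have hya : G.c ≤ ya ∧ ya ≤ G.d ∧ z.2 - r ≤ ya ∧ ya ≤ z.2 + r := by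
        simp only [max_le_iff, le_min_iff] at hya1 hya2; omega
      -- which case: port on the column `a` above the lobe, or port in the lobe rows
      have hport : (ew.1 = G.a ∧ G.c ≤ ew.2) ∨ ew.2 ≤ G.c - 1 := by
        rcases hw6 with h6 | ⟨h6, h7⟩
        · by_cases hx : ew.1 = G.a
          · exact Or.inl ⟨hx, h6⟩
          · exact absurd (memK _ (by omega) hw2 h6 hw5 hw3 hw4) hcase
        · exact Or.inr h7
      -- anchor point `pa` and the start `ps` of the exterior path
      set pa : ℤ × ℤ := if ew.2 ≤ G.c - 1 then (xa, G.c) else (G.a + 1, ya) with hpadef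
      set ps : ℤ × ℤ := if ew.2 ≤ G.c - 1 then (xa, G.c - 1) else (G.a, ya) with hpsdef
      have hlow_rows : ew.2 ≤ G.c - 1 → z.2 - r ≤ G.c - 1 := fun hl => by omega
      have hpaK : pa ∈ K := by
        rw [hpadef]; split_ifs with hl
        · refine memK _ ?_ ?_ ?_ ?_ ?_ ?_ <;> dsimp only <;> omega
        · refine memK _ ?_ ?_ ?_ ?_ ?_ ?_ <;> dsimp only <;> omega
      have hpsadj : planarAdj pa ps := by
        rw [hpadef, hpsdef]; split_ifs
        · -- vertical step `(xa, c) → (xa, c - 1)`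
          right; right; ext <;> simp
        · exact planarAdj_symm (planarAdj_left (by simp) (by simp))
      have hpaE₁ : planar k E₁ ≠ pa := by
        rw [hpadef]; split_ifs with hl
        · intro hE; have := congrArg Prod.fst hE; exact hxae this.symm
        · intro hE; have := congrArg Prod.snd hE; exact hyae this.symm
      have hpaβ' : planar k β' ≠ pa := by
        rw [hβ'p, hpadef]; split_ifs with hl
        · intro hE; have := congrArg Prod.snd hE; simp only at this; exact hyβc this
        · intro hE; have := congrArg Prod.snd hE; simp only at this; exact hyaβ this.symm
      set w'' : slab 3 k := vtx k pa h with hw''def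
      have hw''p : planar k w'' = pa := planar_vtx _ _
      obtain ⟨L, Br, c, spec⟩ := exists_route (xL := G.a + 1) (xR' := z.1 + (r : ℕ)) (xR := z.1 + (r : ℕ))
        (rB := max G.c (z.2 - (r : ℕ))) (rP := min G.d (z.2 + (r : ℕ))) (rT := min G.d (z.2 + (r : ℕ)))
        hk (by omega) le_rfl hrows le_rfl hE₁K hβ'K (by rw [hw''p]; exact hpaK) hE₁β'
        (by rw [hw''p]; exact hpaE₁) (by rw [hw''p]; exact hpaβ')
      have spec' : RouteSpec k K D E₁ β' w'' L Br c := RouteSpec.mono spec subset_rfl hKD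
      -- the exterior L-path from `ps` to `ew`, at height `h`
      obtain ⟨lp, hlp, hlpmem⟩ := exists_lpath_hv ps ew
      set X : List (slab 3 k) := liftH k h lp with hXdef
      have hXne : X ≠ [] := liftH_ne_nil hlp.ne_nil
      have hXprop : ∀ x ∈ X, planar k x ∉ K ∧ planar k x ∈ D ∧ ht x = h := by
        intro x hx
        rw [hXdef, mem_liftH_iff hhk] at hx
        refine ⟨?_, ?_, hx.2⟩
        · rcases hport with ⟨hpa, hpc⟩ | hl
          · have hps : ps = (G.a, ya) := by rw [hpsdef, if_neg (by omega)]
            rw [hps] at hlpmem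
            rcases (hlpmem _).1 hx.1 with ⟨h1, h2, h3⟩ | ⟨h1, h2, h3⟩
            · simp only at h1 h2 h3
              exact notK_a _ (by rw [min_def] at h2; rw [max_def] at h3; split_ifs at h2 h3 <;> omega)
            · exact notK_a _ (by rw [h1, hpa])
          · have hps : ps = (xa, G.c - 1) := by rw [hpsdef, if_pos hl]
            rw [hps] at hlpmem
            rcases (hlpmem _).1 hx.1 with ⟨h1, h2, h3⟩ | ⟨h1, h2, h3⟩
            · exact notK_low _ (by simp only at h1; omega)
            · simp only at h1 h2 h3
              exact notK_low _ (by rw [max_def] at h3; split_ifs at h3 <;> omega)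
        · rcases hport with ⟨hpa, hpc⟩ | hl
          · have hps : ps = (G.a, ya) := by rw [hpsdef, if_neg (by omega)]
            rw [hps] at hlpmem
            rcases (hlpmem _).1 hx.1 with ⟨h1, h2, h3⟩ | ⟨h1, h2, h3⟩
            · simp only at h1 h2 h3
              refine memDS _ ?_ ?_ ?_ ?_ ?_ ?_ <;>
                · rw [min_def] at h2; rw [max_def] at h3; split_ifs at h2 h3 <;> omega
            · simp only at h1 h2 h3
              refine memDS _ ?_ ?_ ?_ ?_ ?_ ?_ <;>
                · rw [min_def] at h2; rw [max_def] at h3; split_ifs at h2 h3 <;> omega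
          · have hps : ps = (xa, G.c - 1) := by rw [hpsdef, if_pos hl]
            rw [hps] at hlpmem
            have hzl := hlow_rows hl
            rcases hw6 with hw6 | ⟨hw6, hw7⟩
            · exact absurd hl (by omega)
            rcases (hlpmem _).1 hx.1 with ⟨h1, h2, h3⟩ | ⟨h1, h2, h3⟩
            · simp only at h1 h2 h3
              refine memDV _ ?_ ?_ ?_ ?_ ?_ ?_ <;>
                · rw [min_def] at h2; rw [max_def] at h3; split_ifs at h2 h3 <;> omega
            · simp only at h1 h2 h3
              refine memDV _ ?_ ?_ ?_ ?_ ?_ ?_ <;>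
                · rw [min_def] at h2; rw [max_def] at h3; split_ifs at h2 h3 <;> omega
      have hXK : ∀ x ∈ X, planar k x ∉ K := fun x hx => (hXprop x hx).1
      have hXD : ∀ x ∈ X, planar k x ∈ D := fun x hx => (hXprop x hx).2.1
      have hXhead : X.head? = some (vtx k ps h) := by
        rw [hXdef, head?_liftH, hlp.head]; rfl
      have hXlast : X.getLast hXne = w' := by
        apply Option.some_injective
        rw [← List.getLast?_eq_some_getLast, hXdef, getLast?_liftH, hlp.last]
        simp [hewdef, hhdef, vtx_planar_ht]
      have hchX : (w'' :: X).IsChain (fun a b => (slabGraph 3 k).Adj a b) := by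
        rw [List.isChain_cons]
        refine ⟨fun y hy => ?_, liftH_isChain h hlp.chain⟩
        rw [hXhead] at hy
        simp only [Option.mem_def, Option.some.injEq] at hy
        rw [← hy, hw''def]
        exact vtx_adj_vtx_planar hpsadj h
      have hXL : ∀ x ∈ X, x ∉ L := fun x hx hm => hXK x hx (spec.hL_sub x hm)
      have hXBr : ∀ x ∈ X, x ∉ c :: Br := by
        intro x hx hm
        rcases List.mem_cons.1 hm with hm | hm
        · exact hXK x hx (hm ▸ spec.hL_sub c spec.hc)
        · exact hXK x hx (spec.hBr_sub x hm)
      have spec₂ := RouteSpec.append_branch X w'' Br hXne spec' hchX (liftH_nodup hlp.nodup) hXL hXBr hXD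
      rw [hXlast] at spec₂
      refine ⟨L, Br ++ X, c, spec₂, spec.hL_sub, fun hm => ?_⟩
      rcases List.mem_append.1 hm with hm | hm
      · exact notK_a _ (by rw [hβp]) (spec.hBr_sub β hm)
      · exact hhβne (hβht ▸ (hXprop β hm).2.2)
  -- the trunk ends at `β`
  have spec₃ : RouteSpec k D D E₁ β w' (L ++ [β]) Br₁ c :=
    RouteSpec.concat_trunk spec₁ hKD hadjβ (notK_L hLK) hβBr₁ hβD
  have hint : ∀ v ∈ L ++ [β], v ≠ E₁ → v ≠ β → planar k v ∈ G.Q.S ∧ planar k v ∉ G.Q.B := by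
    intro v hv _ hvβ
    rcases List.mem_append.1 hv with hv | hv
    · exact ⟨hKS (hLK v hv), fun hB' => notK_a _ hB'.2 (hLK v hv)⟩
    · exact absurd (List.mem_singleton.1 hv) hvβ
  have hE₁β : E₁ ≠ β := fun hE => hE₁B (by rw [he₁def, hE]; exact hβB)
  obtain ⟨sb, hsb⟩ := exists_surgeryB_of_decomp (Q := G.Q) (LobeSetup.DR_subset_R _ _) hDA hγeq hp₀
    hrest hp₀D hE₁D hE₁β hβD hβS hβB hadj hq₁D hc₀ hσ spec₃ hint
  exact ⟨sb, hsb ▸ hDz⟩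

end AtB

/-! ## Direct gluing near `A`, the located-gadget supply, and the gluing lemma in both regimes -/

section Supply

variable {G : LobeSetup} {ω : BondConfig (slab 3 k)} {ρ : ℕ}

/-- **Direct gluing near `A` at a prescribed entry cell, from port data** (L-shaped domain, `A` at least
`2ρ + 8` columns right of the lobe): the far endpoint lies over `S`, the far path enters the box
`(z + B_{ρ+3}) ∩ S`, and the `C`-cluster is glued to `Ā` inside it.
[cite: NewmanTassionWu2017, §3.2 (proof of Theorem 3.7, steps (2)–(3), near A; Fact 2, ω^{(z)})] -/
theorem exists_directGlue_A_lobe_at (hω : ω ⊆ (slabGraph 3 k).edgeSet) (hX : ω ∈ G.Q.evX k)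
    (hAfar : ∀ a'' ∈ G.A, G.a' + 2 * ρ + 8 ≤ a''.1)
    (hsep : ∀ a' ∈ G.A, ∀ c' ∈ G.C, c' ∉ sqBox a' (4 * ρ + 8))
    {c₀ u v : slab 3 k} {L : List (slab 3 k)} (hc₀ : c₀ ∈ slabLift k G.C)
    (hL : IsOSAP k ω (slabLift k G.R ∩ {x | ¬Near k (G.Q.γ k ω) ρ (planar k x)}) {c₀} {u} L)
    (huv : (slabGraph 3 k).Adj u v)
    (hA' : ∃ a' ∈ G.A, a' ∈ sqBox (planar k v) (ρ + 3)) :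
    ∃ dg : DirectGlue k G.R G.C G.A ω, dg.D ⊆ sqBox (planar k v) (ρ + 3) := by
  set z := planar k v with hzdef
  set D := G.DS z (ρ + 3) with hDdef
  obtain ⟨a', ha', ha'z⟩ := hA'
  have hDC : ∀ w ∈ D, w ∉ G.C := by
    intro w hw hwC
    have hwz := LobeSetup.DS_subset_sqBox _ _ hw
    have : w ∈ sqBox a' ((ρ + 3) + (ρ + 3)) := mem_sqBox_add (GlueGeom.mem_sqBox_comm ha'z) hwz
    exact hsep a' ha' w hwC (sqBox_mono _ (by omega) this)
  have hc₀D : planar k c₀ ∉ D := fun h => hDC _ h hc₀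
  have huL : u ∈ L := by
    have := hL.last_mem hL.ne_nil
    rw [Set.mem_singleton_iff] at this
    rw [← this]; exact List.getLast_mem _
  -- the far endpoint lies over `S` (it is within `1` of `v`, which is within `ρ + 3` of a cell of `A`)
  have huS : planar k u ∈ G.S := by
    have huR : planar k u ∈ G.R := (hL.subset u huL).1
    have hu1 : planar k u ∈ sqBox z 1 := planar_mem_sqBox_one_of_adj huv.symm
    rw [mem_sqBox_iff'] at hu1 ha'z
    have := hAfar a' ha'
    rcases LobeSetup.mem_R_iff.1 huR with h | h
    · exact h
    · rw [LobeSetup.mem_V_iff] at h; push_cast at hu1 ha'z this; omega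
  have huD : planar k u ∈ D :=
    LobeSetup.mem_DS_iff.2 ⟨huS, sqBox_mono _ (by omega : 1 ≤ ρ + 3) (planar_mem_sqBox_one_of_adj huv.symm)⟩
  have hheadL : L.head hL.ne_nil = c₀ := by
    have := hL.head_mem hL.ne_nil
    rwa [Set.mem_singleton_iff] at this
  have hheadD : planar k (L.head hL.ne_nil) ∉ D := by rw [hheadL]; exact hc₀D
  obtain ⟨m, w', rest, hm, hLeq, hmD, hw'D, hedge, -, -, hconn, -⟩ :=
    exists_entry (R := G.R) hL.chain hL.nodup (fun x hx => (hL.subset x hx).1) hL.ne_nil hheadD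
      ⟨u, huL, huD⟩
  rw [hheadL] at hconn
  have hadj : (slabGraph 3 k).Adj (m.getLast hm) w' := (SimpleGraph.mem_edgeSet _).1 (hω hedge)
  have hw'L : w' ∈ L := by rw [hLeq]; simp
  have hw'A : planar k w' ∉ G.A := by
    intro hA'
    have hj := hL.openConnIn_of_mem hw'L
    rw [hheadL] at hj
    exact hX.2 ⟨c₀, hc₀, w', hA', openConnIn_mono (Set.inter_subset_left) _ _ hj⟩
  have ha'D : a' ∈ D := LobeSetup.mem_DS_iff.2 ⟨G.hA ha', ha'z⟩
  obtain ⟨dg, hdg⟩ := exists_directGlue (R := G.R) (Src := G.C) (Tg := G.A)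
    ((LobeSetup.DS_subset_S _ _).trans G.S_subset_R) hDC hc₀ (hmD _ (List.getLast_mem hm)) hconn hadj
    hw'D hw'A ha'D ha'
  exact ⟨dg, hdg ▸ LobeSetup.DS_subset_sqBox _ _⟩

/-- **A located gadget at every entry cell inside `R`** (L-shaped domain `R = S ∪ V`; lobe at least
`2ρ + 7` wide; `A` at least `2ρ + 8` columns right of the lobe; `C` at sup-distance `> 2ρ + 3` from `S`;
`dist*(A, C) > 4ρ + 8`): a direct gluing near `A`, the `B`-near surgery, or the plain surgery with a
rectangular or an L-shaped cleared box, according to the position of the entry cell.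
[cite: NewmanTassionWu2017, §3.2 (proof of Theorem 3.7, Fact 2: "For any z ∈ U(ω) … we will construct ω^{(z)}"), Remark 2] -/
theorem exists_gadgetAt_lobe (hk : 1 ≤ k) (hρ : 2 ≤ ρ) (hwide : G.a + 2 * ρ + 6 ≤ G.a')
    (hAfar : ∀ a'' ∈ G.A, G.a' + 2 * ρ + 8 ≤ a''.1)
    (hsep : ∀ a' ∈ G.A, ∀ c' ∈ G.C, c' ∉ sqBox a' (4 * ρ + 8))
    (hfarC : ∀ c' ∈ G.C, ∀ s' ∈ G.S, c' ∉ sqBox s' (2 * ρ + 3))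
    (hω : ω ⊆ (slabGraph 3 k).edgeSet) (hX : ω ∈ G.Q.evXn k ρ) {y : ℤ × ℤ} (hy : y ∈ G.Q.UentR k ρ ω) :
    ∃ ω', GadgetAt G.Q k (ρ + 3) ω ω' y := by
  have hX' : ω ∈ G.Q.evX k := hX.1
  have hA : ω ∈ G.Q.evAB k := hX'.1
  obtain ⟨⟨hnear, u, v, hvy, huv, hufar, c₀, hc₀, hj⟩, hyR⟩ := hy
  subst hvy
  obtain ⟨L, hL⟩ := exists_isOSAP_of_openConnIn hj
  have hvR : v ∈ slabLift k G.R := hyR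
  have hnC : ∀ c' ∈ G.C, c' ∉ sqBox (planar k v) (ρ + 3) := by
    intro c' hc' hc'v
    obtain ⟨g, hg, hvg⟩ := hnear
    have hgS : planar k g ∈ G.S := (G.Q.γ_spec hA).1.subset g hg
    have : c' ∈ sqBox (planar k g) (ρ + (ρ + 3)) := mem_sqBox_add hvg hc'v
    exact hfarC c' hc' (planar k g) hgS (by rwa [show 2 * ρ + 3 = ρ + (ρ + 3) by ring])
  by_cases hA' : ∃ a' ∈ G.A, a' ∈ sqBox (planar k v) (ρ + 3)
  · obtain ⟨dg, hdg⟩ := exists_directGlue_A_lobe_at hω hX' hAfar hsep hc₀ hL huv hA'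
    exact ⟨_, gadgetAt_of_directGlue_A (Q := G.Q) hX' dg hdg⟩
  push Not at hA'
  obtain ⟨hz1, hz2, hz3, hz4⟩ := LobeSetup.contact_bounds hA (show planar k v ∈ G.R from hvR) hnear
  by_cases hcol : (planar k v).1 - (ρ + 3) ≤ G.a
  · obtain ⟨sb, hsb⟩ := exists_surgeryB_lobe_at hk hρ hω hX' hwide hc₀ hL huv hvR hnear hA' hnC hcol
    exact ⟨_, gadgetAt_of_surgeryB (Q := G.Q) hX' sb hsb⟩
  · push Not at hcol
    by_cases hlobe : (planar k v).1 - ρ ≤ G.a'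
    · obtain ⟨sx, hsx⟩ := exists_surgery_lobe_at_R hk hρ hω hX' hc₀ hL huv hvR hnear hA' hnC (by omega) hlobe
      exact ⟨_, gadgetAt_of_surgery (Q := G.Q) hX' sx hsx⟩
    · -- the box has few columns over the lobe: the far endpoint lies over `S`
      have huL : u ∈ L := by
        have := hL.last_mem hL.ne_nil
        rw [Set.mem_singleton_iff] at this
        rw [← this]; exact List.getLast_mem _
      have huS : u ∈ slabLift k G.S := by
        have huR : planar k u ∈ G.R := (hL.subset u huL).1
        have hu1 : planar k u ∈ sqBox (planar k v) 1 := planar_mem_sqBox_one_of_adj huv.symm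
        rw [mem_sqBox_iff'] at hu1
        rcases LobeSetup.mem_R_iff.1 huR with h | h
        · exact h
        · rw [LobeSetup.mem_V_iff] at h; push_cast at hu1; omega
      obtain ⟨sx, hsx⟩ := exists_surgery_lobe_at_S hk hρ hω hX' hc₀ hL huv hvR huS hnear hA' hnC (by omega)
      exact ⟨_, gadgetAt_of_surgery (Q := G.Q) hX' sx hsx⟩

/-- **NTW 2017, Theorem 3.7, HIGH-PROBABILITY regime, L-shaped domain — unconditional.** For every
`k ≥ 1`, `ρ ≥ 2`, `ε > 0`, `η > 0` there is `δ > 0` such that for every `LobeSetup` `G` (lobe at least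
`2ρ + 7` wide, `A` at least `2ρ + 8` columns right of the lobe, `dist*(A, C) > 4ρ + 8`,
`dist*(C, S) > 2ρ + 3`) and every `p ∈ [ε, 1-ε]`:
`P_p[C̄ ⟷^{R̄} 𝒩(Γ̄, ρ)] ≥ 1 - δ ⟹ P_p[C ⟷^R A] ≥ 1 - η` (`Γ = Γ_min^S(A, B)`, `B` the left side of `S`).
[cite: NewmanTassionWu2017, Theorem 3.7 (high-probability regime), Remark 2 (rectilinear domains)] -/
theorem glue_highProb_lobe (k ρ : ℕ) (hk : 1 ≤ k) (hρ : 2 ≤ ρ) {ε : ℝ} (hε : 0 < ε) {η : ℝ} (hη : 0 < η) :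
    ∃ δ : ℝ, 0 < δ ∧ ∀ (G : LobeSetup), G.a + 2 * ρ + 6 ≤ G.a' →
      (∀ a'' ∈ G.A, G.a' + 2 * ρ + 8 ≤ a''.1) →
      (∀ a' ∈ G.A, ∀ c' ∈ G.C, c' ∉ sqBox a' (4 * ρ + 8)) →
      (∀ c' ∈ G.C, ∀ s' ∈ G.S, c' ∉ sqBox s' (2 * ρ + 3)) →
      ∀ (p : unitInterval), ε ≤ (p : ℝ) → (p : ℝ) ≤ 1 - ε →
      1 - δ ≤ (bondPercolation (slabGraph 3 k) p).real (G.Q.evNear k ρ) →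
      1 - η ≤ (bondPercolation (slabGraph 3 k) p).real (G.Q.evCA k) := by
  obtain ⟨δ, hδ, H⟩ := glue_highProb_of_gadgets_entR k ρ (ρ + 3) hε hη
  refine ⟨δ, hδ, fun G hwide hAfar hsep hfarC p hpε hp1 hN =>
    H G.Q (fun c' hc' s' hs' h => ?_) p hpε hp1 ?_ hN⟩
  · exact hfarC c' hc' s' hs' (sqBox_mono _ (by omega) h)
  · intro ω hω hX y hy
    exact exists_gadgetAt_lobe hk hρ hwide hAfar hsep hfarC hω hX hy

/-- **NTW 2017, Theorem 3.7, LINEAR regime, L-shaped domain — unconditional**: under the same side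
conditions, for `0 < p < 1`: `P_p[A ⟷^S B, C̄ ⟷^{R̄} 𝒩(Γ̄, ρ)] ≤ (1 + λ_p^s) · P_p[C ⟷^R A]`,
`s = 3(5k+4)(4ρ+13)²`. [cite: NewmanTassionWu2017, Theorem 3.7 with Remark 3 (h₀(x) ≥ c₀ x), Remark 2] -/
theorem glue_linear_lobe (G : LobeSetup) (hk : 1 ≤ k) {ρ : ℕ} (hρ : 2 ≤ ρ) (hwide : G.a + 2 * ρ + 6 ≤ G.a')
    (hAfar : ∀ a'' ∈ G.A, G.a' + 2 * ρ + 8 ≤ a''.1)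
    (hsep : ∀ a' ∈ G.A, ∀ c' ∈ G.C, c' ∉ sqBox a' (4 * ρ + 8))
    (hfarC : ∀ c' ∈ G.C, ∀ s' ∈ G.S, c' ∉ sqBox s' (2 * ρ + 3))
    (p : unitInterval) (hp0 : 0 < (p : ℝ)) (hp1 : (p : ℝ) < 1) :
    (bondPercolation (slabGraph 3 k) p).real (G.Q.evAB k ∩ G.Q.evNear k ρ) ≤
      (1 + (2 / min (p : ℝ) (1 - p)) ^ (3 * ((5 * k + 4) * (2 * (2 * (ρ + 3)) + 1) ^ 2))) *
        (bondPercolation (slabGraph 3 k) p).real (G.Q.evCA k) :=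
  real_evAB_inter_evNear_le_of_gadgetsAt (Q := G.Q) (fun c' hc' s' hs' h => hfarC c' hc' s' hs' (sqBox_mono _ (by omega) h))
    (fun _ω hω hX _y hy => exists_gadgetAt_lobe hk hρ hwide hAfar hsep hfarC hω hX hy) p hp0 hp1

end Supply

end NTW17


end Literature.Probability.Percolation

end
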